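import Literature.MathematicalPhysics.QuantumFieldTheory.LatticeGaugeDobrushinPoincare
import Summits.Ventures.YMGap.RobustBall.PerturbedSpecification
import HarnessLib

/-!
# Venture YMGap, track ROBUST-BALL — the one-link conditional law of the perturbed specification

HONEST FRAMING. WHAT THIS IS: a venture file (cell `pub-ymgap`, track Y2 ROBUST-BALL, seat rb-p1), the
second brick of the robust single-link Dobrushin door. For the perturbed lattice action `β S_W + W`
(`perturbedYM ρ β W supp` of `PerturbedSpecification.lean`) it identifies the ONE-LINK conditional law
and proves its FINITE RANGE, reducing Dobrushin's condition in the Vasserstein form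
(`IsKRContraction`) for the member to a one-link Kantorovich–Rubinstein estimate — exactly as the
tree's `LatticeGaugeDobrushin.lean` does for the Wilson action. WHAT THIS IS NOT: no estimate of the
one-link law (that is `RobustOneLink.lean`), no mass-gap statement, no number; strong-coupling lattice
bookkeeping only, no continuum / Millennium claim.

## Contents

* `siteLaw_tilted_map_glueWith_pi` — generic: for a Gibbsian specification with a priori PROBABILITY
  measure `ν` and energies `φ_Λ`, the one-site law at `e` with boundary condition `ω` is
  `ν.tilted (s ↦ φ_{e}(ω^{e ← s}))` (push-forward commutes with tilting).
* `siteLaw_perturbedYM_eq_tilted_haar` — the one-link law of the member is Haar measure tilted by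
  `g ↦ -β S_{e}(ω^{e←g}) - H^W_{e}(ω^{e←g})`.
* `perturbedNbr supp e` — the range of that law: the plaquette neighbours of `e` (tree `linkPlaqNbr`)
  together with the links of the interaction sets listed at `e` (`supp {e}`), minus `e`; finite because
  `supp {e}` is (local finiteness, referee test T0.4).
* `perturbedEnergy_singleton_update_congr`, `siteLaw_perturbedYM_congr` — FINITE RANGE: the one-link
  law depends on the boundary condition only through `perturbedNbr supp e`.
* `isKRContraction_perturbedYM` — Dobrushin's condition for the member REDUCES to the one-link
  Kantorovich–Rubinstein contraction over `perturbedNbr` (the analogue of the tree's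
  `isKRContraction_ymSpecification`).
* `siteLaw_perturbedYM_thooft` — for `SU(N)` at bare coupling `N β` ('t Hooft scaling, the cell's
  convention): the one-link law is `σ_N.tilted (g ↦ N Re tr(g B_ω) - V_ω(g))` with the tree's staple
  field `B_ω = stapleField β e ω` and the ONE-LINK PERTURBATION
  `V_ω(g) = hamiltonianIn W supp {e} (ω^{e←g}) = ∑_{X ∈ supp{e}, e ∈ X} W_X(ω^{e←g})` — the object the
  robust one-link lemma estimates.

## References

* H. Föllmer, LNM 1362 (1988), Ch. I (2.20) (Dobrushin's condition, Vasserstein form, finite range).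
* H.-O. Georgii, *Gibbs Measures and Phase Transitions* (2011), Def. 2.9, (2.11), Prop. 8.8.
* The tree: `Literature/MathematicalPhysics/QuantumFieldTheory/LatticeGaugeDobrushin.lean`,
  `…/LatticeGaugeDobrushinPoincare.lean` (`siteLaw_ymSpecification_thooft`).
-/

noncomputable section

open MeasureTheory Filter Function
open Literature.Probability.LatticeModels
open Literature.Probability.LatticeModels.DobrushinMetric
open Literature.MathematicalPhysics.QuantumLattice
open Literature.MathematicalPhysics.QuantumFieldTheory hiding ZdEdge

namespace Summit.Ventures.YMGap.RobustBall

/-! ### Generic: the one-site law of a Gibbsian specification with a priori probability measure -/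

section Generic

variable {V S : Type*} [DecidableEq V] [MeasurableSpace S]

/-- **The one-site law of a Gibbsian specification with an a priori probability measure**: for the
kernels `γ_Λ(· | η) = (ν^{⊗Λ} ∘ glueWith⁻¹(·, η)).tilted φ_Λ`, the law of the spin at `e` under
`γ_{e}(· | ω)` is `ν.tilted (s ↦ φ_{e}(ω^{e ← s}))`: on the one-point index set gluing is
`update ω e ∘ eval`, push-forward commutes with tilting (tree `map_tilted_comp`) and `eval` pushes the
one-fold product of `ν` to `ν` (Föllmer 1988, Ch. I §2.1, `π_k(· | η)`; the tree's
`siteLaw_ymSpecification_eq_tilted_haar` is the Wilson instance). -/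
theorem siteLaw_tilted_map_glueWith_pi (ν : Measure S) [IsProbabilityMeasure ν]
    (φ : Finset V → (V → S) → ℝ) (e : V) (hφ : Measurable (φ {e})) (ω : V → S) :
    siteLaw (fun Λ η => ((Measure.pi fun _ : ↥Λ => ν).map (glueWith Λ · η)).tilted (φ Λ)) e ω =
      ν.tilted fun s => φ {e} (Function.update ω e s) := by
  set π : (↥({e} : Finset V) → S) → S := fun ζ => ζ ⟨e, Finset.mem_singleton_self e⟩ with hπ
  have hπm : Measurable π := measurable_pi_apply _
  have hglue : Measurable fun ζ : ↥({e} : Finset V) → S => glueWith {e} ζ ω := measurable_glueWith _ ω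
  have hF' : Measurable fun s : S => φ {e} (Function.update ω e s) := hφ.comp (measurable_update ω)
  have hgl : (fun ζ : ↥({e} : Finset V) → S => glueWith {e} ζ ω) = Function.update ω e ∘ π := by
    funext ζ z
    by_cases hz : z = e
    · subst hz
      simp [hπ]
    · rw [Function.comp_apply, Function.update_of_ne hz,
        glueWith_apply_not_mem _ _ _ (by simpa using hz)]
  have hcomp : φ {e} ∘ (fun ζ : ↥({e} : Finset V) → S => glueWith {e} ζ ω) =
      (fun s : S => φ {e} (Function.update ω e s)) ∘ π := by
    rw [hgl]
    rfl
  have heval : (fun σ : V → S => σ e) ∘ (fun ζ : ↥({e} : Finset V) → S => glueWith {e} ζ ω) = π := by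
    funext ζ
    simp [hπ]
  have hev : (Measure.pi fun _ : ↥({e} : Finset V) => ν).map π = ν :=
    (MeasureTheory.measurePreserving_eval (fun _ : ↥({e} : Finset V) => ν)
      ⟨e, Finset.mem_singleton_self e⟩).map_eq
  show (((Measure.pi fun _ : ↥({e} : Finset V) => ν).map (fun ζ => glueWith {e} ζ ω)).tilted
      (φ {e})).map (fun σ : V → S => σ e) = _
  rw [← map_tilted_comp _ hglue hφ, Measure.map_map (measurable_pi_apply e) hglue, heval, hcomp,
    map_tilted_comp _ hπm hF', hev]

end Generic

/-! ### The one-link law of the perturbed lattice Yang–Mills specification -/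

section OneLink

variable {d N : ℕ} {G : Type*} [Group G] (ρ : G →* Matrix (Fin N) (Fin N) ℂ)
  [TopologicalSpace G] [IsTopologicalGroup G] [CompactSpace G] [MeasurableSpace G] [BorelSpace G]
  [SecondCountableTopology G]

/-- **The one-link conditional law of the member is a tilted Haar measure**:
`ν^W_{e,ω}(dg) = Z⁻¹ exp(-β S_{e}(ω^{e←g}) - H^W_{e}(ω^{e←g})) dg` (Haar `dg`), where `S_{e}` is the
boundary Wilson action of the plaquettes through `e` and `H^W_{e} = ∑_{X ∈ supp{e}, e ∈ X} W_X` — the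
instance `ν = Haar`, `φ = perturbedEnergy` of `siteLaw_tilted_map_glueWith_pi`
(Seiler LNP 159 Ch. 2; Georgii 2011 Def. 2.9). -/
theorem siteLaw_perturbedYM_eq_tilted_haar (hρ : Continuous ρ) (β : ℝ) {W : Potential (ZdEdge d) G}
    (hWm : ∀ X, Measurable (W X)) (supp : Finset (ZdEdge d) → Finset (Finset (ZdEdge d)))
    (e : ZdEdge d) (ω : LGConfig d G) :
    siteLaw (perturbedYM ρ β W supp) e ω =
      (haarProbability G).tilted fun g => perturbedEnergy ρ β W supp {e} (Function.update ω e g) :=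
  siteLaw_tilted_map_glueWith_pi (haarProbability G) (fun Λ => perturbedEnergy ρ β W supp Λ) e
    (measurable_perturbedEnergy ρ hρ β hWm supp {e}) ω

omit [TopologicalSpace G] [IsTopologicalGroup G] [CompactSpace G] [MeasurableSpace G] [BorelSpace G]
  [SecondCountableTopology G] in
/-- **The range of the one-link law of the member**: the plaquette neighbours of `e` (tree
`linkPlaqNbr e`, `6(d-1)` links) together with all links of the interaction sets listed at `e`
(`supp {e}`), with `e` removed. A finite set: this is where the local finiteness of the support family
(`Potential.IsSupportedBy`) is consumed (referee test T0.4). -/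
def perturbedNbr (supp : Finset (ZdEdge d) → Finset (Finset (ZdEdge d))) (e : ZdEdge d) :
    Finset (ZdEdge d) :=
  (linkPlaqNbr e ∪ ((supp {e}).filter fun X => e ∈ X).biUnion id).erase e

omit [TopologicalSpace G] [IsTopologicalGroup G] [CompactSpace G] [MeasurableSpace G] [BorelSpace G]
  [SecondCountableTopology G] in
/-- A link is not in its own range. -/
theorem not_mem_perturbedNbr (supp : Finset (ZdEdge d) → Finset (Finset (ZdEdge d))) (e : ZdEdge d) :
    e ∉ perturbedNbr supp e :=
  Finset.notMem_erase e _

omit [TopologicalSpace G] [IsTopologicalGroup G] [CompactSpace G] [MeasurableSpace G] [BorelSpace G]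
  [SecondCountableTopology G] in
/-- Plaquette neighbours are in the range. -/
theorem linkPlaqNbr_subset_perturbedNbr (supp : Finset (ZdEdge d) → Finset (Finset (ZdEdge d)))
    (e : ZdEdge d) : linkPlaqNbr e ⊆ perturbedNbr supp e := by
  intro y hy
  refine Finset.mem_erase.2 ⟨?_, Finset.mem_union_left _ hy⟩
  rintro rfl
  exact not_mem_linkPlaqNbr _ hy

omit [TopologicalSpace G] [IsTopologicalGroup G] [CompactSpace G] [MeasurableSpace G] [BorelSpace G]
  [SecondCountableTopology G] in
/-- Links (other than `e`) of an interaction set listed at `e` and containing `e` are in the range. -/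
theorem mem_perturbedNbr_of_mem_supp {supp : Finset (ZdEdge d) → Finset (Finset (ZdEdge d))}
    {e y : ZdEdge d} {X : Finset (ZdEdge d)} (hX : X ∈ supp {e}) (heX : e ∈ X) (hy : y ∈ X)
    (hye : y ≠ e) : y ∈ perturbedNbr supp e :=
  Finset.mem_erase.2 ⟨hye, Finset.mem_union_right _
    (Finset.mem_biUnion.2 ⟨X, Finset.mem_filter.2 ⟨hX, heX⟩, hy⟩)⟩

/-- Membership in the range: a plaquette neighbour, or a link `≠ e` of a listed set through `e`. -/
theorem mem_perturbedNbr_iff {supp : Finset (ZdEdge d) → Finset (Finset (ZdEdge d))}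
    {e y : ZdEdge d} : y ∈ perturbedNbr supp e ↔
      y ≠ e ∧ (y ∈ linkPlaqNbr e ∨ ∃ X ∈ supp {e}, e ∈ X ∧ y ∈ X) := by
  simp only [perturbedNbr, Finset.mem_erase, Finset.mem_union, Finset.mem_biUnion, Finset.mem_filter,
    id, and_assoc]

omit [TopologicalSpace G] [IsTopologicalGroup G] [CompactSpace G] [BorelSpace G]
  [SecondCountableTopology G] in
/-- **Finite range of the one-link energy**: boundary conditions agreeing on `perturbedNbr supp e`
give the same one-link energy `g ↦ -β S_{e}(η^{e←g}) - H^W_{e}(η^{e←g})` — the Wilson part reads only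
the plaquettes through `e` (`isCylinder_wilsonBoundaryAction_holds`), the term `W_X`, `X ∈ supp{e}`,
only the links of `X` (`Potential.IsAdapted`). -/
theorem perturbedEnergy_singleton_update_congr (β : ℝ) {W : Potential (ZdEdge d) G}
    (hW : W.IsAdapted) (supp : Finset (ZdEdge d) → Finset (Finset (ZdEdge d))) (e : ZdEdge d)
    {η η' : LGConfig d G} (h : ∀ z ∈ perturbedNbr supp e, η z = η' z) (g : G) :
    perturbedEnergy ρ β W supp {e} (Function.update η e g) =
      perturbedEnergy ρ β W supp {e} (Function.update η' e g) := by
  have hupd : ∀ z, z ∈ perturbedNbr supp e ∨ z = e →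
      Function.update η e g z = Function.update η' e g z := by
    intro z hz
    by_cases hze : z = e
    · subst hze; simp
    · rw [Function.update_of_ne hze, Function.update_of_ne hze]
      exact h z (hz.resolve_right hze)
  have hS : wilsonBoundaryAction ρ {e} (Function.update η e g) =
      wilsonBoundaryAction ρ {e} (Function.update η' e g) := by
    refine isCylinder_wilsonBoundaryAction_holds ρ {e} fun z hz => hupd z ?_
    by_cases hze : z = e
    · exact Or.inr hze
    · exact Or.inl (linkPlaqNbr_subset_perturbedNbr supp e (Finset.mem_erase.2 ⟨hze, hz⟩))
  have hH : hamiltonianIn W supp {e} (Function.update η e g) =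
      hamiltonianIn W supp {e} (Function.update η' e g) := by
    refine Finset.sum_congr rfl fun X hX => (hW X).1 fun z hz => hupd z ?_
    by_cases hze : z = e
    · exact Or.inr hze
    · obtain ⟨hX1, hX2⟩ := Finset.mem_filter.1 hX
      obtain ⟨e', he'⟩ := hX2
      have hee' : e' = e := Finset.mem_singleton.1 (Finset.mem_inter.1 he').2
      exact Or.inl (mem_perturbedNbr_of_mem_supp hX1 (hee' ▸ (Finset.mem_inter.1 he').1) hz hze)
  simp only [perturbedEnergy, hS, hH]

/-- **Finite range of the one-link law of the member** (Föllmer 1988, Ch. I, (2.20)): the conditional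
law of `U_e` under `γ^W_{e}(· | η)` depends on `η` only through `η|_{perturbedNbr supp e}`. -/
theorem siteLaw_perturbedYM_congr (hρ : Continuous ρ) (β : ℝ) {W : Potential (ZdEdge d) G}
    (hW : W.IsAdapted) (supp : Finset (ZdEdge d) → Finset (Finset (ZdEdge d))) (e : ZdEdge d)
    {η η' : LGConfig d G} (h : ∀ z ∈ perturbedNbr supp e, η z = η' z) :
    siteLaw (perturbedYM ρ β W supp) e η = siteLaw (perturbedYM ρ β W supp) e η' := by
  rw [siteLaw_perturbedYM_eq_tilted_haar ρ hρ β (fun X => (hW X).2) supp e η,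
    siteLaw_perturbedYM_eq_tilted_haar ρ hρ β (fun X => (hW X).2) supp e η']
  congr 1
  funext g
  exact perturbedEnergy_singleton_update_congr ρ β hW supp e h g

/-- **Dobrushin's condition for the member reduces to the one-link Kantorovich–Rubinstein
contraction over `perturbedNbr`** (Föllmer 1988, Ch. I, (2.20) with the finite range of the perturbed
specification): given nonnegative influence coefficients `C` and the one-link contraction estimate for
boundary conditions differing at one link of the range, `perturbedYM ρ β W supp` satisfies
`IsKRContraction` with `nbr = perturbedNbr supp` — the analogue of the tree's
`isKRContraction_ymSpecification`. -/
theorem isKRContraction_perturbedYM (hρ : Continuous ρ) (β : ℝ) {W : Potential (ZdEdge d) G}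
    (hW : W.IsAdapted) (supp : Finset (ZdEdge d) → Finset (Finset (ZdEdge d))) {r : G → G → ℝ}
    {C : ZdEdge d → ZdEdge d → ℝ} (hC0 : ∀ x y, 0 ≤ C x y)
    (hcontr : ∀ (x : ZdEdge d), ∀ y ∈ perturbedNbr supp x, ∀ (ω η : LGConfig d G),
      (∀ z, z ≠ y → ω z = η z) → ∀ (φ : G → ℝ) (L : ℝ), Measurable φ → (∃ M, ∀ s, |φ s| ≤ M) →
        0 ≤ L → (∀ a b, |φ a - φ b| ≤ L * r a b) →
        |∫ s, φ s ∂(siteLaw (perturbedYM ρ β W supp) x ω) -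
            ∫ s, φ s ∂(siteLaw (perturbedYM ρ β W supp) x η)| ≤ C x y * L * r (ω y) (η y)) :
    IsKRContraction (perturbedYM (d := d) ρ β W supp) r (perturbedNbr supp) C :=
  ⟨not_mem_perturbedNbr supp, hC0, fun x _ _ h => siteLaw_perturbedYM_congr ρ hρ β hW supp x h, hcontr⟩

end OneLink

/-! ### `SU(N)`, 't Hooft scaling: the one-link law as a perturbed tilted Haar measure -/

section SUN

variable {d N : ℕ}

/-- **The one-link law of the perturbed `SU(N)` theory at bare coupling `N β`** is the Haar
probability measure `σ_N` tilted by `g ↦ N Re tr(g B_ω) - V_ω(g)`, with the tree's staple field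
`B_ω = stapleField β e ω` (`‖B_ω‖_op ≤ 2(d-1)|β|`) and the ONE-LINK PERTURBATION
`V_ω(g) = H^W_{e}(ω^{e←g}) = ∑_{X ∈ supp{e}, e ∈ X} W_X(ω^{e←g})`: the one-link Wilson action in
't Hooft form is `const + N Re tr(g B_ω)` (`thooft_wilsonBoundaryAction_update`) and tilting forgets
additive constants (`tilted_const_add_eq`). At `W = 0` this is the tree's
`siteLaw_ymSpecification_thooft`. -/
theorem siteLaw_perturbedYM_thooft (β : ℝ) {W : Potential (ZdEdge d) (Matrix.specialUnitaryGroup (Fin N) ℂ)}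
    (hWm : ∀ X, Measurable (W X)) (supp : Finset (ZdEdge d) → Finset (Finset (ZdEdge d)))
    (e : ZdEdge d) (ω : LGConfig d (Matrix.specialUnitaryGroup (Fin N) ℂ)) :
    siteLaw (perturbedYM (fundamentalRep (Fin N)) (N * β) W supp) e ω =
      (haarProbability (Matrix.specialUnitaryGroup (Fin N) ℂ)).tilted
        fun g => (N : ℝ) * ((g : Matrix (Fin N) (Fin N) ℂ) * stapleField β e ω).trace.re -
          hamiltonianIn W supp {e} (Function.update ω e g) := by
  classical
  haveI : SecondCountableTopology (Matrix (Fin N) (Fin N) ℂ) :=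
    inferInstanceAs (SecondCountableTopology (Fin N → Fin N → ℂ))
  haveI : SecondCountableTopology (Matrix.specialUnitaryGroup (Fin N) ℂ) :=
    Topology.IsEmbedding.subtypeVal.secondCountableTopology
  rw [siteLaw_perturbedYM_eq_tilted_haar _ (continuous_fundamentalRep (Fin N)) _ hWm]
  have : (fun g : Matrix.specialUnitaryGroup (Fin N) ℂ =>
      perturbedEnergy (fundamentalRep (Fin N)) (N * β) W supp {e} (Function.update ω e g)) =
      fun g : Matrix.specialUnitaryGroup (Fin N) ℂ =>
        -((N : ℝ) * β) * ((N : ℝ) * (plaquettesTouching {e}).card) +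
          ((N : ℝ) * ((g : Matrix (Fin N) (Fin N) ℂ) * stapleField β e ω).trace.re -
            hamiltonianIn W supp {e} (Function.update ω e g)) := by
    funext g
    rw [perturbedEnergy, thooft_wilsonBoundaryAction_update β e ω g]
    ring
  rw [this, tilted_const_add_eq]

end SUN

end Summit.Ventures.YMGap.RobustBall
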